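import Literature.NumberTheory.LFunctions.DedekindResidueCondQnLowerBound
import HarnessLib

/-!
# R for EVERY number field: `κ_K ≥ Q^{−A(n)}` in all degrees, and the registered stub `stub_residueFromStark`

Topic `Summits/QuantumAdvantage/QuantumAdvantage/Theorems`, cell B2b-1 (linnik-cubic), PART B (seat 4), crux
`DegreeOnePrimesEscape` (stmt-QuantumAdvantage-11543) of route `LinnikCubicClassGroups`.
HONEST FRAMING: the value of this file is a THEOREM (kernel-checked) — NOT summit progress.

* `Residue.one_le_residue_of_finrank_eq_one` — a degree-one field has `κ_K ≥ 1` (`r₁ = 1`, `r₂ = 0`, `w_K = 2`,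
  `|d_K| = 1`, `h_K ≥ 1`, and `R_K ≥ 1` from Minkowski's bound `t^{rank} ≤ R_K` at `rank = 0`,
  `Literature.NumberTheory.NumberFields.pow_rank_le_regulator_of_le_norm_logEmbedding`).
* `Residue.residueLowerBound_all : ∀ n, ∃ A ≥ 0, ∀ K of degree n, condQn K ^ (−A) ≤ κ_K` — ALL degrees, ALL fields
  (degree `≥ 2`: `ThornerZaman.exists_condQn_rpow_neg_le_residue`, Literature `DedekindResidueCondQnLowerBound.lean`;
  degree `1`: the bullet above with `A = 0`; degree `0`: vacuous).
* `stub_residueFromStark` — the registered stub R of line `subgroup-orthogonality-escape`, verbatim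
  (`StarkNoQuadSubfieldInexplicit → ResidueLowerBound`); both of its hypotheses (Stark's zero-free interval and
  "no quadratic subfield") are now UNUSED: the residue bound holds unconditionally for every number field.
-/

noncomputable section

open Module NumberField NumberField.InfinitePlace NumberField.Units
open Literature.NumberTheory.LFunctions Literature.NumberTheory.LFunctions.NumberField
  Literature.NumberTheory.NumberFields

namespace Summit.QuantumAdvantage.QuantumAdvantage.Theorems.DegreeOnePrimesEscape

namespace Residue

/-- A number field of degree `1` has `|d_K| = 1` (it is `ℚ`). [folklore]
(Same statement as `Literature…natAbs_discr_eq_one_of_finrank_eq_one`; re-proved here to keep the imports light.) -/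
theorem abs_discr_eq_one_of_finrank_eq_one (K : Type) [Field K] [NumberField K]
    (h : Module.finrank ℚ K = 1) : |(discr K : ℝ)| = 1 := by
  have hbot : (⊥ : IntermediateField ℚ K) = ⊤ := by
    apply IntermediateField.eq_of_le_of_finrank_eq bot_le
    rw [IntermediateField.finrank_bot, IntermediateField.finrank_top', h]
  have e : K ≃ₐ[ℚ] ℚ := (IntermediateField.topEquiv.symm.trans
    (IntermediateField.equivOfEq hbot.symm)).trans (IntermediateField.botEquiv ℚ K)
  rw [NumberField.discr_eq_discr_of_algEquiv _ e, NumberField.discr_rat]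
  simp

open scoped Classical in
/-- **A degree-one number field has `κ_K ≥ 1`** (in fact `= 1`): `κ_K = 2^{r₁}(2π)^{r₂} R h/(w √|d|)` with
`r₁ = 1`, `r₂ = 0`, `w = 2`, `|d| = 1`, `h ≥ 1` and `R ≥ 1` (Minkowski's `t^{rank} ≤ R` at `rank = 0`). [folklore] -/
theorem one_le_residue_of_finrank_eq_one (K : Type) [Field K] [NumberField K]
    (h1 : Module.finrank ℚ K = 1) : 1 ≤ dedekindZeta_residue K := by
  have hrc : nrRealPlaces K + 2 * nrComplexPlaces K = 1 := by rw [card_add_two_mul_card_eq_rank, h1]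
  have hc : nrComplexPlaces K = 0 := by omega
  have hr : nrRealPlaces K = 1 := by omega
  have hrank : rank K = 0 := by
    rw [rank, card_eq_nrRealPlaces_add_nrComplexPlaces, hr, hc]
  have hw : torsionOrder K = 2 := torsionOrder_eq_two_of_odd_finrank (by rw [h1]; exact odd_one)
  have hd : |(discr K : ℝ)| = 1 := abs_discr_eq_one_of_finrank_eq_one K h1
  have hreg : 1 ≤ regulator K := by
    obtain ⟨g, hg, hgap⟩ := exists_norm_logEmbedding_gt_of_finrank_le 1
    have := pow_rank_le_regulator_of_le_norm_logEmbedding K hg (fun u hu => (hgap K h1.le u hu).le)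
    rwa [hrank, pow_zero] at this
  have hh : (1 : ℝ) ≤ classNumber K := by exact_mod_cast classNumber_pos K
  rw [dedekindZeta_residue_def, hr, hc, hw, hd]
  have : (2 : ℝ) ^ 1 * (2 * Real.pi) ^ 0 * regulator K * (classNumber K : ℝ) / (((2 : ℕ) : ℝ) * Real.sqrt 1) =
      regulator K * classNumber K := by
    rw [Real.sqrt_one]; push_cast; ring
  rw [this]
  exact one_le_mul_of_one_le_of_one_le hreg hh

/-- **R for every number field, every degree:** `∀ n, ∃ A = A(n) ≥ 0, ∀ K of degree n, Q^{−A} ≤ κ_K`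
(`Q = condQn K = |d_K| n^n`).  Degree `≥ 2`: class number formula + regulator lower bound
(`ThornerZaman.exists_condQn_rpow_neg_le_residue`); degree `1`: `κ_K ≥ 1 = Q^0`; degree `0`: no such field.
No hypothesis on subfields, no zero-free region. [folklore] -/
theorem residueLowerBound_all : ∀ n : ℕ, ∃ A : ℝ, 0 ≤ A ∧ ∀ (K : Type) [Field K] [NumberField K],
    Module.finrank ℚ K = n → ThornerZaman.condQn K ^ (-A) ≤ NumberField.dedekindZeta_residue K := by
  intro n
  rcases Nat.lt_or_ge 1 n with hn | hn
  · exact ThornerZaman.exists_condQn_rpow_neg_le_residue n hn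
  · refine ⟨0, le_rfl, fun K _ _ hK => ?_⟩
    have hpos : 0 < Module.finrank ℚ K := Module.finrank_pos
    have h1 : Module.finrank ℚ K = 1 := by omega
    rw [neg_zero, Real.rpow_zero]
    exact one_le_residue_of_finrank_eq_one K h1

end Residue

/-- **Registered stub R · `stub_residueFromStark` of line `subgroup-orthogonality-escape`, PROVED** (signature
verbatim: Stark's inexplicit zero-free interval ⇒ the residue lower bound for fields without quadratic subfield).
Both hypotheses are unused: `Residue.residueLowerBound_all` gives the bound for every number field. -/
theorem stub_residueFromStark :
    (∀ n : ℕ, ∃ c : ℝ, 0 < c ∧ ∀ (K : Type) [Field K] [NumberField K], Module.finrank ℚ K = n →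
      (∀ F : IntermediateField ℚ K, Module.finrank ℚ F ≠ 2) →
      ∀ σ : ℝ, 1 - c / Real.log ((NumberField.discr K).natAbs : ℝ) ≤ σ → σ < 1 →
        Literature.NumberTheory.LFunctions.dedekindZetaCont K σ ≠ 0) →
    ∀ n : ℕ, ∃ A : ℝ, 0 ≤ A ∧ ∀ (K : Type) [Field K] [NumberField K], Module.finrank ℚ K = n →
      (∀ F : IntermediateField ℚ K, Module.finrank ℚ F ≠ 2) →
      Literature.NumberTheory.LFunctions.NumberField.ThornerZaman.condQn K ^ (-A) ≤
        NumberField.dedekindZeta_residue K := by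
  intro _ n
  obtain ⟨A, hA0, hA⟩ := Residue.residueLowerBound_all n
  exact ⟨A, hA0, fun K _ _ hK _ => hA K hK⟩

end Summit.QuantumAdvantage.QuantumAdvantage.Theorems.DegreeOnePrimesEscape

end
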